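import Summits.CriticalPhenomena.SAWScalingLimit.Theorems.IsingBoundaryRatio.Negative.IsingBoundaryRatioLattice
import Literature.Probability.LatticeModels.RandomCluster

/-!
# Objects and intermediate statements of the line `fk-anchor-transfer` for the crux
`SAWLoopFugacityFlow.IsingBoundaryRatio` (stmt-CriticalPhenomena-10650; line lead, crux protocol;
skeleton `Summits/CriticalPhenomena/SAWScalingLimit/Cruxes/IsingBoundaryRatio/Lines/fk_anchor_transfer.lean`)

The crux's open lever `AnchorLocality` (anchor locality of the free critical Ising two-point function
at a rough marked prime end of a Jordan domain) is attacked through its Fortuin–Kasteleyn proof. This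
file DEFINES the finite-volume objects and NAMES the intermediate statements that the registered stubs
of the line (`stub_chartAnnulusSeparation`, `stub_roughHalfAnnulusRSW`, `stub_armOriginForgettingCore`,
`stub_localAgreementTransfer`) speak about, so that the stub files
`Theorems/SAWLoopFugacityFlowIsingBoundaryRatio<Stub>.lean` and the skeleton can import one copy of
them. Nothing is asserted here: every `def … : Prop` below is a TARGET of the line (proved, or to be
proved, in a stub file), not a cited fact.

* `LocalAgreement Ω p ε δ G Λ` — a finite-volume graph `(G, Λ)` on `Site 2` agrees with the mesh graph
  `Ω_δ = discreteDomainGraph Ω δ` at every site of `Λ` whose mesh point lies in `B(p, ε)` ("a finite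
  supergraph of the local graph, attached only away from `p`");
* `freeTwoPoint G Λ x y` — the free critical Ising two-point function of `(G, Λ)` (`= Negative.T Ω δ x y` for the
  mesh graph, `freeTwoPoint_discreteDomainGraph`);
* `ArmOriginForgettingAt Ω p`, `ArmOriginForgetting` — arm-origin forgetting (a boundary Harnack
  principle for `freeTwoPoint` in the anchor variable, uniform over supergraphs and far spins) at a boundary
  point / at both marked points of every Dobrushin domain: the analytic heart of the line;
* `ChartAnnulusSeparation` — lattice paths crossing a conformal annulus of the chordal chart visit it;
* `annIn`, `annBody`, `AnnSep`, `AnnCross`, `RoughHalfAnnulusRSW` — the lattice conformal half-annuli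
  at the marked point `a = D.pt 0`, their open separation / open radial crossing events, and the RSW
  statement (crossing bounds uniform in the configuration off the annulus, conditional-cylinder form as
  in `rcMeasure_real_inter_cylinder_le_mul_fromEdgeSet`) that Chelkak–Duminil-Copin–Hongler 2016
  (arXiv:1312.7785, Thm 1.1) supplies for discrete topological rectangles of bounded discrete extremal
  length.

Sources for the shape of the statements: H. Kesten, *The incipient infinite cluster in two-dimensional
percolation*, PTRF 73 (1986); C. Garban, G. Pete, O. Schramm, *Pivotal, cluster and interface measures
for critical planar percolation*, JAMS 26 (2013) §3; F. Camia, C. Garban, C. Newman, *Planar Ising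
magnetization field I*, Ann. Probab. 43 (2015) §3.2 (coupling lemma); D. Chelkak, H. Duminil-Copin,
C. Hongler, *Crossing probabilities in topological rectangles for the critical planar FK-Ising model*,
EJP 21 (2016) Thm 1.1. Deliberately NOT here: any theorem of the line.
-/

noncomputable section

open scoped Classical Topology
open Filter Set Metric
open Literature.Probability.LatticeModels Literature.Probability.RandomPlanarGeometry
open UpperHalfPlane (upperHalfPlaneSet)

namespace Summit.CriticalPhenomena.SAWScalingLimit.Theorems.IsingBoundaryRatio

open Summit.CriticalPhenomena.SAWScalingLimit.Theorems.IsingBoundaryRatio.Negative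

/-! ## Finite supergraphs of the local mesh graph -/

/-- **Local agreement** of a finite-volume graph `(G, Λ)` on `Site 2` with the mesh graph `Ω_δ`
of `Ω` inside the ball `B(p, ε)`: every site of `Λ` whose mesh point lies in the ball has exactly
its `Ω_δ`-neighbours as `G`-neighbours, and these neighbours lie in `Λ` again — so the free Ising
model of `(G, Λ)` (interaction edges `edgesIn G Λ`) has the same interaction edges as `Ω_δ` at
every such site, while `G` is arbitrary elsewhere. -/
def LocalAgreement (Ω : Set ℂ) (p : ℂ) (ε δ : ℝ) (G : SimpleGraph (Site 2))
    (Λ : Finset (Site 2)) : Prop :=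
  ∀ w ∈ Λ, meshPoint δ w ∈ Metric.ball p ε →
    ∀ v : Site 2, (G.Adj w v ↔ (discreteDomainGraph Ω δ).Adj w v) ∧
      ((discreteDomainGraph Ω δ).Adj w v → v ∈ Λ)

/-- The free critical Ising two-point function `⟨σ_xσ_y⟩^free_{(G,Λ); β_c, 0}` of a finite volume
`Λ` of a locally finite graph `G` on `Site 2`. -/
def freeTwoPoint (G : SimpleGraph (Site 2)) [G.LocallyFinite] (Λ : Finset (Site 2)) (x y : Site 2) : ℝ :=
  isingTwoPoint G Λ criticalBetaTwo 0 .free x y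

/-- `freeTwoPoint` of the mesh graph with its mesh-domain volume is the crux's normal form `Negative.T`. -/
theorem freeTwoPoint_discreteDomainGraph :
    ∀ (Ω : Set ℂ) (δ : ℝ) (x y : Site 2),
      freeTwoPoint (discreteDomainGraph Ω δ) (meshDomainFinset Ω δ) x y = T Ω δ x y :=
  fun _ _ _ _ => rfl

/-! ## Arm-origin forgetting (the analytic heart, local supergraph form) -/

/-- **Arm-origin forgetting at a boundary point `p` of the domain `Ω`.** For all `ε, c, η > 0`
there is `r > 0` such that for all small `δ`, for ANY two finite-volume graphs `(G₁, Λ₁)`, `(G₂, Λ₂)`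
on `Site 2` that agree locally with `Ω_δ` in `B(p, ε)`, anchors `x, x'` within `r` of `p` and far
spins `y₁, y₂` at distance `≥ c` from `p` (joined to the anchors in the respective graphs), the double
ratio `[τ₁(x,y₁)/τ₁(x',y₁)] / [τ₂(x,y₂)/τ₂(x',y₂)]` is within `η` of `1`: the ratio of the two anchors'
correlations with a far spin forgets everything beyond `B(p, ε)` — the far graph, the far spin, the
boundary condition they induce (Edwards–Sokal: `τ = φ⁰[x ↔ y]`; conditionally on the FK arm from the
anchors reaching chart scale `ρ ≫ r`, the configuration beyond the outermost open crosscut of a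
conformal half-annulus is independent of the inside, such crosscuts exist in each of `N → ∞`
half-annuli with conditional probability bounded below, and the laws of the outermost crosscuts under
two far conditionings overlap, so the far dependence contracts geometrically in `N`). A TARGET of the
line (stub `stub_armOriginForgettingCore` proves it at `pt 0` from the two statements below). -/
def ArmOriginForgettingAt (Ω : Set ℂ) (p : ℂ) : Prop :=
  ∀ (ε c η : ℝ), 0 < ε → 0 < c → 0 < η → ∃ r : ℝ, 0 < r ∧ ∀ᶠ δ in 𝓝[>] (0 : ℝ),
    ∀ (G₁ : SimpleGraph (Site 2)) [G₁.LocallyFinite] (G₂ : SimpleGraph (Site 2)) [G₂.LocallyFinite]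
      (Λ₁ Λ₂ : Finset (Site 2)) (x x' y₁ y₂ : Site 2),
      LocalAgreement Ω p ε δ G₁ Λ₁ → LocalAgreement Ω p ε δ G₂ Λ₂ →
      x ∈ Λ₁ → x ∈ Λ₂ → x' ∈ Λ₁ → x' ∈ Λ₂ → y₁ ∈ Λ₁ → y₂ ∈ Λ₂ →
      dist (meshPoint δ x) p < r → dist (meshPoint δ x') p < r →
      c ≤ dist (meshPoint δ y₁) p → c ≤ dist (meshPoint δ y₂) p →
      G₁.Reachable x y₁ → G₁.Reachable x' y₁ → G₂.Reachable x y₂ → G₂.Reachable x' y₂ →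
      |freeTwoPoint G₁ Λ₁ x y₁ / freeTwoPoint G₁ Λ₁ x' y₁ / (freeTwoPoint G₂ Λ₂ x y₂ / freeTwoPoint G₂ Λ₂ x' y₂) - 1| < η

/-- **Arm-origin forgetting** at both marked prime ends of every Dobrushin domain (a TARGET). -/
def ArmOriginForgetting : Prop :=
  ∀ (D : DobrushinDomain) (i : Fin 2), ArmOriginForgettingAt D.carrier (D.pt i)

/-! ## The chordal chart: annulus separation and the lattice conformal half-annuli -/

/-- **Chart-annulus separation** (lattice, deterministic; a TARGET, stub `stub_chartAnnulusSeparation`):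
in the chordal chart `φ : ℍ → D` (`φ(0) = a`, `φ(∞) = b`), for `0 < ρ₁ < ρ₂` and all small `δ`, every
path of `Ω_δ` from a site of chart radius `‖φ⁻¹‖ ≤ ρ₁` to a site of chart radius `≥ ρ₂` passes through
a site of chart radius in `(ρ₁, ρ₂)` (consecutive sites are `δ` apart and the capped chart radius
`min(‖φ⁻¹ ·‖, ρ₂)` extends continuously, hence uniformly continuously, to the compact closure of `D`).
Junk-free: the sites of a nonempty path of `Ω_δ` have mesh points in `D`. -/
def ChartAnnulusSeparation : Prop :=
  ∀ (D : DobrushinDomain) (φ : ConformalEquiv upperHalfPlaneSet D.carrier),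
    D.IsChordalUniformizing φ → ∀ (ρ₁ ρ₂ : ℝ), 0 < ρ₁ → ρ₁ < ρ₂ →
      ∀ᶠ δ in 𝓝[>] (0 : ℝ), ∀ (u v : Site 2) (w : (discreteDomainGraph D.carrier δ).Walk u v),
        ‖φ.symm (meshPoint δ u)‖ ≤ ρ₁ → ρ₂ ≤ ‖φ.symm (meshPoint δ v)‖ →
          ∃ z ∈ w.support, ρ₁ < ‖φ.symm (meshPoint δ z)‖ ∧ ‖φ.symm (meshPoint δ z)‖ < ρ₂

/-- The inside of the lattice conformal half-annulus of chart radii `(ρ, Mρ)` at `a = D.pt 0`: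
sites of `Λ` with mesh point in `B(a, ε)` and chart radius `≤ ρ`. -/
def annIn (D : DobrushinDomain) (φ : ConformalEquiv upperHalfPlaneSet D.carrier) (ε δ ρ : ℝ)
    (Λ : Finset (Site 2)) : Set Λ :=
  {v | meshPoint δ v.1 ∈ Metric.ball (D.pt 0) ε ∧ ‖φ.symm (meshPoint δ v.1)‖ ≤ ρ}

/-- The lattice conformal half-annulus of chart radii `(ρ, Mρ)` at `a = D.pt 0`: sites of `Λ` with
mesh point in `B(a, ε)` and chart radius in `(ρ, Mρ)`. -/
def annBody (D : DobrushinDomain) (φ : ConformalEquiv upperHalfPlaneSet D.carrier) (M ε δ ρ : ℝ)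
    (Λ : Finset (Site 2)) : Set Λ :=
  {v | meshPoint δ v.1 ∈ Metric.ball (D.pt 0) ε ∧ ρ < ‖φ.symm (meshPoint δ v.1)‖ ∧
    ‖φ.symm (meshPoint δ v.1)‖ < M * ρ}

/-- **Open separation of the half-annulus**: some set `S` of annulus sites, pairwise joined by
`ω`-open paths inside the annulus, meets every path of `H` from the inside of the annulus to the
complement of inside-and-annulus ("an open crosscut around `a` at chart scale `ρ`"). -/
def AnnSep {Λ : Finset (Site 2)} (H : SimpleGraph Λ) (In Ann : Set Λ)
    (ω : Literature.Probability.Percolation.BondConfig Λ) : Prop :=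
  ∃ S : Set Λ, S ⊆ Ann ∧ (∀ u ∈ S, ∀ v ∈ S, ω ∈ Literature.Probability.Percolation.openConnIn Ann u v) ∧
    ∀ (a b : Λ), a ∈ In → b ∉ In ∪ Ann → ∀ p : H.Walk a b, ∃ z ∈ p.support, z ∈ S

/-- **Open radial crossing of the half-annulus**: an `ω`-open path of `H` from the inside to the
complement of inside-and-annulus, all of whose other sites lie in the annulus. -/
def AnnCross {Λ : Finset (Site 2)} (H : SimpleGraph Λ) (In Ann : Set Λ)
    (ω : Literature.Probability.Percolation.BondConfig Λ) : Prop :=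
  ∃ (a b : Λ) (p : H.Walk a b), a ∈ In ∧ b ∉ In ∪ Ann ∧
    (∀ z ∈ p.support, z = a ∨ z = b ∨ z ∈ Ann) ∧ ∀ e ∈ p.edges, e ∈ ω

/-- **Rough half-annulus RSW at the marked prime end `a = D.pt 0`** (uniform in boundary
conditions, conditional-cylinder form; a TARGET, stub `stub_roughHalfAnnulusRSW`). For the chordal
chart `φ` and a ratio `M > 1` there is `c > 0` such that for every localisation radius `ε` there is
`ρ₀ > 0` with: for every chart scale `ρ < ρ₀`, all small `δ`, every finite-volume graph `(G, Λ)`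
agreeing locally with `Ω_δ` in `B(a, ε)` and every configuration `ξ` of the edges NOT touching the
annulus, under the free critical FK-Ising measure of `(G, Λ)` (`q = 2`, `p = 1 - e^{-2β_c}`):
`P(AnnSep ∩ {ω off the annulus = ξ}) ≥ c · P(ω off = ξ)` and
`P(AnnCross ∩ {ω off = ξ}) ≤ (1 - c) · P(ω off = ξ)`. Source of the eventual proof:
Chelkak–Duminil-Copin–Hongler 2016 (arXiv:1312.7785) Thm 1.1 (i)–(ii) for the discrete topological
rectangle carved out of the annulus sites (sides on `∂Ω_δ`, top/bottom along the chart level sets),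
whose discrete extremal length is bounded in terms of `M` alone once `δ` is small (Chelkak 2012,
toolbox, §6). -/
def RoughHalfAnnulusRSW : Prop :=
  ∀ (D : DobrushinDomain) (φ : ConformalEquiv upperHalfPlaneSet D.carrier),
    D.IsChordalUniformizing φ → ∀ (M : ℝ), 1 < M → ∃ c : ℝ, 0 < c ∧ ∀ (ε : ℝ), 0 < ε →
      ∃ ρ₀ : ℝ, 0 < ρ₀ ∧ ∀ (ρ : ℝ), 0 < ρ → ρ < ρ₀ → ∀ᶠ δ in 𝓝[>] (0 : ℝ),
        ∀ (G : SimpleGraph (Site 2)) [G.LocallyFinite] (Λ : Finset (Site 2)),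
          LocalAgreement D.carrier (D.pt 0) ε δ G Λ →
          ∀ (ξ : Set (Sym2 Λ)),
            let H : SimpleGraph Λ := G.comap Subtype.val
            let In : Set Λ := annIn D φ ε δ ρ Λ
            let Ann : Set Λ := annBody D φ M ε δ ρ Λ
            let U : Set (Sym2 Λ) := {e | e ∈ H.edgeSet ∧ ∃ v ∈ Ann, v ∈ e}
            let P := rcMeasure H (1 - Real.exp (-2 * criticalBetaTwo)) 2 ∅
            c * P.real {ω | ω ∩ Uᶜ = ξ} ≤ P.real ({ω | AnnSep H In Ann ω} ∩ {ω | ω ∩ Uᶜ = ξ}) ∧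
            P.real ({ω | AnnCross H In Ann ω} ∩ {ω | ω ∩ Uᶜ = ξ}) ≤ (1 - c) * P.real {ω | ω ∩ Uᶜ = ξ}

end Summit.CriticalPhenomena.SAWScalingLimit.Theorems.IsingBoundaryRatio

end

/-! ## Arm-origin forgetting, REPAIRED (in-volume connectivity)

`ArmOriginForgettingAt` above is FALSE for every Jordan domain (`not_armOriginForgetting`,
`Theorems/SAWLoopFugacityFlowIsingBoundaryRatioArmOriginForgettingFalse.lean`): a far spin `y ∈ Λ` that is
`G`-reachable from the anchor only through vertices OUTSIDE the finite volume `Λ` has `freeTwoPoint G Λ x y = 0`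
(no interaction edge of `edgesIn G Λ` reaches it), so the double ratio is the junk value `0` and `|0 - 1| = 1`.
The repair below (cycle-c1 lead, adopted by the line in rev 5) asks for walks WITH SUPPORT IN `Λ` — exactly what
the Edwards–Sokal reading `freeTwoPoint G Λ x y = φ⁰_{(G|_Λ)}[x ↔ y]` needs and what makes all four two-point
functions strictly positive (GKS I). The line's stubs 1c'/1e' speak about these primed statements. -/

namespace Summit.CriticalPhenomena.SAWScalingLimit.Theorems.IsingBoundaryRatio

open scoped Topology
open Literature.Probability.LatticeModels Literature.Probability.RandomPlanarGeometry

/-- **Arm-origin forgetting at a boundary point `p` of `Ω`, repaired form** (a TARGET of the line, the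
analytic heart; stub `stub_armOriginForgettingCore'` proves it at `pt 0` of a Dobrushin domain from
`ChartAnnulusSeparation` and `RoughHalfAnnulusRSW`). Identical to `ArmOriginForgettingAt` except that the
anchors `x, x'` are joined to the far spins `y₁, y₂` by walks of `G₁`, `G₂` whose support lies in the finite
volume `Λ₁`, `Λ₂` (in-volume connectivity): for all `ε, c, η > 0` there is `r > 0` such that for all small
`δ`, for any two finite-volume graphs agreeing locally with `Ω_δ` in `B(p, ε)`, anchors within `r` of `p`, far
spins at distance `≥ c` from `p`, the double ratio
`[τ₁(x,y₁)/τ₁(x',y₁)] / [τ₂(x,y₂)/τ₂(x',y₂)]`, `τᵢ = freeTwoPoint Gᵢ Λᵢ`, is within `η` of `1`. -/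
def ArmOriginForgettingAt' (Ω : Set ℂ) (p : ℂ) : Prop :=
  ∀ (ε c η : ℝ), 0 < ε → 0 < c → 0 < η → ∃ r : ℝ, 0 < r ∧ ∀ᶠ δ in 𝓝[>] (0 : ℝ),
    ∀ (G₁ : SimpleGraph (Site 2)) [G₁.LocallyFinite] (G₂ : SimpleGraph (Site 2)) [G₂.LocallyFinite]
      (Λ₁ Λ₂ : Finset (Site 2)) (x x' y₁ y₂ : Site 2),
      LocalAgreement Ω p ε δ G₁ Λ₁ → LocalAgreement Ω p ε δ G₂ Λ₂ →
      x ∈ Λ₁ → x ∈ Λ₂ → x' ∈ Λ₁ → x' ∈ Λ₂ → y₁ ∈ Λ₁ → y₂ ∈ Λ₂ →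
      dist (meshPoint δ x) p < r → dist (meshPoint δ x') p < r →
      c ≤ dist (meshPoint δ y₁) p → c ≤ dist (meshPoint δ y₂) p →
      (∃ w : G₁.Walk x y₁, ∀ v ∈ w.support, v ∈ Λ₁) → (∃ w : G₁.Walk x' y₁, ∀ v ∈ w.support, v ∈ Λ₁) →
      (∃ w : G₂.Walk x y₂, ∀ v ∈ w.support, v ∈ Λ₂) → (∃ w : G₂.Walk x' y₂, ∀ v ∈ w.support, v ∈ Λ₂) →
      |freeTwoPoint G₁ Λ₁ x y₁ / freeTwoPoint G₁ Λ₁ x' y₁ /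
          (freeTwoPoint G₂ Λ₂ x y₂ / freeTwoPoint G₂ Λ₂ x' y₂) - 1| < η

/-- **Arm-origin forgetting, repaired form**, at both marked prime ends of every Dobrushin domain (a TARGET;
hypothesis of the line's stub 1e' `anchorLocality_of_armOriginForgetting'`). -/
def ArmOriginForgetting' : Prop :=
  ∀ (D : DobrushinDomain) (i : Fin 2), ArmOriginForgettingAt' D.carrier (D.pt i)

end Summit.CriticalPhenomena.SAWScalingLimit.Theorems.IsingBoundaryRatio

/-! ## The heart in percolation language (rev 5, cycle-c2 lead)

By Edwards–Sokal for finite volumes (`stub_freeTwoPoint_eq_fkConn`,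
`Theorems/SAWLoopFugacityFlowIsingBoundaryRatioEdwardsSokalFinset.lean`),
`freeTwoPoint G Λ x y = φ⁰_{G.comap val}[x ↔ y]` is the connection probability of the FREE critical FK–Ising
(random-cluster, `q = 2`, `p = 1 - e^{-2β_c}`) measure of the finite graph `G.comap Subtype.val` on `↥Λ`. The
statement below is `ArmOriginForgettingAt'` with the four two-point functions replaced by these connection
probabilities — the form in which the intended proof (conditional RSW in the lattice conformal half-annuli,
conditional FKG, domain Markov at the outermost open separating set, Kesten/Basu–Sapozhnikov-type ratio
coupling) operates, and in which the tree's random-cluster library (`RandomCluster*`, `rcMeasure_fkg_holds`,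
`RandomClusterSuccessiveConditioning`, `RandomClusterConditionalDomination`, `RandomClusterExploredWiring`) applies. -/

namespace Summit.CriticalPhenomena.SAWScalingLimit.Theorems.IsingBoundaryRatio

open scoped Classical Topology
open Literature.Probability.LatticeModels Literature.Probability.RandomPlanarGeometry
open Literature.Probability.Percolation (openConn)

/-- **FK arm-origin forgetting at a boundary point `p` of `Ω`** (a TARGET of the line: the analytic heart in
percolation language; stub `stub_fkArmOriginForgetting` proves it at `pt 0` of a Dobrushin domain from
`ChartAnnulusSeparation` and `RoughHalfAnnulusRSW`, and `ArmOriginForgettingAt'` follows by Edwards–Sokal). For all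
`ε, c, η > 0` there is `r > 0` such that for all small `δ`, for any two finite-volume graphs `(G₁, Λ₁)`, `(G₂, Λ₂)`
on `Site 2` agreeing locally with `Ω_δ` in `B(p, ε)`, anchors `x, x'` within `r` of `p`, far vertices `y₁, y₂` at
distance `≥ c` from `p`, joined to the anchors by walks with support in the finite volumes, the double ratio of
free critical FK–Ising connection probabilities
`[φ₁(x ↔ y₁)/φ₁(x' ↔ y₁)] / [φ₂(x ↔ y₂)/φ₂(x' ↔ y₂)]`, `φᵢ = φ⁰_{Gᵢ.comap val}` on `↥Λᵢ`, is within `η` of `1`: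
the ratio of the two anchors' arm probabilities towards a far target forgets everything beyond `B(p, ε)`. -/
def FKArmOriginForgettingAt (Ω : Set ℂ) (p : ℂ) : Prop :=
  ∀ (ε c η : ℝ), 0 < ε → 0 < c → 0 < η → ∃ r : ℝ, 0 < r ∧ ∀ᶠ δ in 𝓝[>] (0 : ℝ),
    ∀ (G₁ : SimpleGraph (Site 2)) [G₁.LocallyFinite] (G₂ : SimpleGraph (Site 2)) [G₂.LocallyFinite]
      (Λ₁ Λ₂ : Finset (Site 2)) (x x' y₁ y₂ : Site 2),
      LocalAgreement Ω p ε δ G₁ Λ₁ → LocalAgreement Ω p ε δ G₂ Λ₂ →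
      ∀ (hx₁ : x ∈ Λ₁) (hx₂ : x ∈ Λ₂) (hx'₁ : x' ∈ Λ₁) (hx'₂ : x' ∈ Λ₂) (hy₁ : y₁ ∈ Λ₁) (hy₂ : y₂ ∈ Λ₂),
      dist (meshPoint δ x) p < r → dist (meshPoint δ x') p < r →
      c ≤ dist (meshPoint δ y₁) p → c ≤ dist (meshPoint δ y₂) p →
      (∃ w : G₁.Walk x y₁, ∀ v ∈ w.support, v ∈ Λ₁) → (∃ w : G₁.Walk x' y₁, ∀ v ∈ w.support, v ∈ Λ₁) →
      (∃ w : G₂.Walk x y₂, ∀ v ∈ w.support, v ∈ Λ₂) → (∃ w : G₂.Walk x' y₂, ∀ v ∈ w.support, v ∈ Λ₂) →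
      let P₁ := rcMeasure (G₁.comap (Subtype.val : ↥Λ₁ → Site 2)) (1 - Real.exp (-2 * criticalBetaTwo)) 2 ∅
      let P₂ := rcMeasure (G₂.comap (Subtype.val : ↥Λ₂ → Site 2)) (1 - Real.exp (-2 * criticalBetaTwo)) 2 ∅
      |P₁.real (openConn (⟨x, hx₁⟩ : ↥Λ₁) ⟨y₁, hy₁⟩) / P₁.real (openConn (⟨x', hx'₁⟩ : ↥Λ₁) ⟨y₁, hy₁⟩) /
          (P₂.real (openConn (⟨x, hx₂⟩ : ↥Λ₂) ⟨y₂, hy₂⟩) / P₂.real (openConn (⟨x', hx'₂⟩ : ↥Λ₂) ⟨y₂, hy₂⟩)) -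
        1| < η

end Summit.CriticalPhenomena.SAWScalingLimit.Theorems.IsingBoundaryRatio
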